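import Summits.BirchSwinnertonDyer.BirchSwinnertonDyer.Theorems.SignedLowerHalvesSmallImageLowerHalfBothSignsRttD2J2Corestriction
import Summits.BirchSwinnertonDyer.BirchSwinnertonDyer.Theorems.SignedLowerHalvesSmallImageLowerHalfBothSignsRttD2J2Levelwise
import HarnessLib

/-!
# Route `SignedLowerHalves`, crux L `SmallImageLowerHalfBothSigns` (stmt-BirchSwinnertonDyer-23599), line `rtt_w3` v14 — E2, junction row (J2), UNTWISTED specialisation:
# `res` is `Λ`-SEMILINEAR along `φ₀ : 𝒪⟦T₂⟧⟦T₁⟧ → 𝒪⟦T⟧` (`T₂ ↦ 0`) and FACTORS through `QuotSMulTop T₂ H` as a `Λ_𝒪`-LINEAR map `s : H1/T₂H1 →ₗ[Λ_𝒪] B`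

INPUTS hand `bsd-inputs-honda-p1` g23 under LEAD `cruxlead-stmt-BirchSwinnertonDyer-23599` g11 (BRIEF-E2 rev 5 §2 row J2; design note «U» on the bus 2026-08-30T18:18Z). Sequel of
`…RttD2J2Corestriction` (p782174: `res`, pinned levelwise, with the `T₁`/`C (C c)`/`T₂` clauses) and `…RttD2J2Levelwise` (rigidity of the pins). For a basis
`(γ₁, γ₂)` with `γ₂ ∈ κ₁.kerSubgroup` (the dual choice; `γ₂` acts trivially on the `κ₁`-line):
* §1 ★ `spLevel_smul` — the levelwise corestriction `cor_{K̃_n/K^{(1)}_n}` intertwines the FULL `Λ_{𝒪,2}`-action of the two-variable level (`layerModuleO₂`, p777117) with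
  the `Λ_𝒪`-action of the `κ₁`-level (`cycLayerModuleO`, p782087) along `φ₀ := PowerSeries.map constantCoeff` (`T₁ ↦ T`, `T₂ ↦ 0`, `C (C c) ↦ C c`) — Kaplansky (a), two variables
  (`LocallyNilpotent.map_smul₂_of_comp_eq`), for the `Λ_{𝒪,2}`-structure on the target obtained by restriction along `φ₀`;
* §2 ★★ `coresHom_smul : res (F • x) = φ₀ F • res x` for EVERY `F` (from §1 + the two rigidity lemmas), and the UNTWISTED SPECIALISATION ★★★ `exists_specialisationLinearMap`:
  for any `f : Λ_{𝒪,2}` killed by `res` (e.g. `f = C X = T₂`, `res_C_X_smul_eq_zero`; or the frame's `C (X − C 0)`) and ANY `Λ_𝒪`-structure on `QuotSMulTop f H1` pinned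
  by the frame's `hιH : l • x = (map C l) • x`, a `Λ_𝒪`-LINEAR `s : QuotSMulTop f H1 →ₗ[Λ_𝒪] B` with `s [x] = res x` (and levelwise pin `D₁.proj n k (s [x]) = spLevel (D₂.proj n k x)`).
This is the J2 map `sp¹` of `charRoad_E2_of_roadD_junction(_exact/_of_isUnit_nsub)` in the UNTWISTED frame (b = 0, datum for the character of `T*`); the twisted frame
(b ≠ 0) needs the level twist `tw` first (design note, pending the LEAD's ruling). What remains of J2 either way (research): `coker s` f.g. torsion and `hcoker`
(⟸ `coker sp¹ ↪ H²₂[f]`, the base-change sequence). THEOREMS + `letI` recipes; no named fact, no `sorry`; crux L, crux M, E2 and BSD remain OPEN and are proved for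
NO curve by any of this. References: [Kaplansky1954] §19 (a); [Lang1990] Ch. 5 §1; [NeukirchSchmidtWingberg2008] I §5 Prop. 1.5.2–1.5.4; [JohnsonLeungKings2011] §4.2, Cor. 5.3.
-/

set_option autoImplicit false
-- the Theorems namespace of this sub repeats the summit name by design (D-0017 nested layout)
set_option linter.dupNamespace false

noncomputable section

open scoped NumberField PowerSeries Pointwise
open CategoryTheory Field IsDedekindDomain
open Literature.NumberTheory.GaloisRepresentations
open Literature.NumberTheory.EllipticCurves
open Literature.NumberTheory.ComplexMultiplication.EllipticUnits
open Literature.NumberTheory.ComplexMultiplication.EllipticUnits.JohnsonLeungKings2011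
open Literature.Algebra.Module.LocallyNilpotent
open Summit.BirchSwinnertonDyer.BirchSwinnertonDyer.Theorems.SmallImageRttD2J1

namespace Summit.BirchSwinnertonDyer.BirchSwinnertonDyer.Theorems.SmallImageRttD2J2

variable {K : Type} [Field K] [NumberField K] {p : ℕ} [Fact p.Prime] (S : Set (PadicAlgCl p))

/-- **`φ₀ : Λ_{𝒪,2} = 𝒪⟦T₂⟧⟦T₁⟧ → Λ_𝒪 = 𝒪⟦T⟧`, the UNTWISTED specialisation `T₂ ↦ 0`, `T₁ ↦ T`** (coefficientwise `constantCoeff`): the frame's `φ` at `b = 0`.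
[cite: JohnsonLeungKings2011, §4.1–§4.2 (arXiv p0012:L39–60)] -/
abbrev phi0 : IwasawaAlgebraO₂ S →+* IwasawaAlgebraO S :=
  PowerSeries.map (PowerSeries.constantCoeff : PowerSeries (padicCoeffIntegers S) →+* padicCoeffIntegers S)

/-- `φ₀ X = X`. [cite: JohnsonLeungKings2011, §4.2 (arXiv p0012:L109–112)] -/
theorem phi0_X : phi0 S (PowerSeries.X : IwasawaAlgebraO₂ S) = PowerSeries.X := PowerSeries.map_X _

/-- `φ₀ (C g) = C (constantCoeff g)`; in particular `φ₀ (C X) = 0` and `φ₀ (C (C c)) = C c`. [cite: JohnsonLeungKings2011, §4.2 (arXiv p0012:L109–112)] -/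
theorem phi0_C (g : PowerSeries (padicCoeffIntegers S)) : phi0 S (PowerSeries.C g : IwasawaAlgebraO₂ S) = PowerSeries.C (PowerSeries.constantCoeff g) :=
  PowerSeries.map_C _ _

/-- `φ₀ ∘ (map C) = id`: the constants-embedding `Λ_𝒪 → Λ_{𝒪,2}` of the frame's `hιH` is a section of `φ₀`. [cite: JohnsonLeungKings2011, §4.1 Def. 4.1 (arXiv p0012:L59–60)] -/
theorem phi0_map_C (l : IwasawaAlgebraO S) :
    phi0 S (PowerSeries.map (PowerSeries.C : padicCoeffIntegers S →+* PowerSeries (padicCoeffIntegers S)) l) = l := by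
  rw [phi0, ← RingHom.comp_apply, ← PowerSeries.map_comp]
  have h : (PowerSeries.constantCoeff : PowerSeries (padicCoeffIntegers S) →+* padicCoeffIntegers S).comp PowerSeries.C = RingHom.id _ :=
    RingHom.ext fun a ↦ PowerSeries.constantCoeff_C a
  rw [h, PowerSeries.map_id]
  rfl

/-! ## §1 The levelwise corestriction intertwines the full actions -/

section Level

variable (κ₁ κ₂ : ZpExtension K p) (γ₁ γ₂ : absoluteGaloisGroup K) (θ : absoluteGaloisGroup K →ₜ* (padicCoeffIntegers S)ˣ) (𝔣 : Ideal (𝓞 K))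
  {i : ℕ} (hi : i ≤ 2)

/-- The `Λ_{𝒪,2}`-structure of the `κ₁`-level group by restriction along `φ₀` of its `Λ_𝒪`-structure `cycLayerModuleO` (activate with `letI`). [cite: Lang1990, Ch. 5 §1] -/
@[reducible] def cycLayerModuleO₂ (n k : ℕ) : Module (IwasawaAlgebraO₂ S) (cycLayerCohO S κ₁ θ (suppPF p 𝔣) n k i) :=
  letI := cycLayerModuleO S κ₁ γ₁ θ (suppPF p 𝔣) hi n k
  Module.compHom _ (phi0 S)

/-- The intermediate `𝒪⟦T₂⟧`-structure of the `κ₁`-level group: `g ↦ constantCoeff g` acting through the `𝒪`-structure (activate with `letI`). [cite: Lang1990, Ch. 5 §1] -/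
@[reducible] def cycLayerModuleInner (n k : ℕ) : Module (PowerSeries (padicCoeffIntegers S)) (cycLayerCohO S κ₁ θ (suppPF p 𝔣) n k i) :=
  letI := levelModuleO S (suppPF p 𝔣) θ (κ₁.layerSubgroup n) k i
  Module.compHom _ (PowerSeries.constantCoeff : PowerSeries (padicCoeffIntegers S) →+* padicCoeffIntegers S)

/-- Unfolding the restricted `Λ_{𝒪,2}`-action: `F • w = φ₀ F • w`. [cite: Lang1990, Ch. 5 §1] -/
theorem cycLayerModuleO₂_smul (n k : ℕ) (F : IwasawaAlgebraO₂ S) (w : cycLayerCohO S κ₁ θ (suppPF p 𝔣) n k i) :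
    (letI := cycLayerModuleO₂ S κ₁ γ₁ θ 𝔣 hi n k; F • w) = (letI := cycLayerModuleO S κ₁ γ₁ θ (suppPF p 𝔣) hi n k; phi0 S F • w) := rfl

omit [NumberField K] in
/-- Unfolding the intermediate action: `g • w = (constantCoeff g) • w`. [cite: Lang1990, Ch. 5 §1] -/
theorem cycLayerModuleInner_smul (n k : ℕ) (g : PowerSeries (padicCoeffIntegers S)) (w : cycLayerCohO S κ₁ θ (suppPF p 𝔣) n k i) :
    (letI := cycLayerModuleInner S κ₁ θ 𝔣 (i := i) n k; g • w) =
      (letI := levelModuleO S (suppPF p 𝔣) θ (κ₁.layerSubgroup n) k i; PowerSeries.constantCoeff g • w) := rfl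

include hi in
/-- ★ **The levelwise corestriction intertwines the FULL actions**: for `γ₂ ∈ Gal(K̄/K^{(1)}_n)` (so `conj_{γ₂} = id` on the `κ₁`-level),
`spLevel n k i (F • w) = (φ₀ F) • spLevel n k i w` for every `F ∈ Λ_{𝒪,2}` — the two-variable level with `layerModuleO₂`, the `κ₁`-level with `cycLayerModuleO`
(Kaplansky (a), `LocallyNilpotent.map_smul₂_of_comp_eq`: `spLevel` is `𝒪`-linear and intertwines `conj_{γ₁} − 1` with itself and `conj_{γ₂} − 1` with `0`).
[cite: Kaplansky1954, §19 statement (a) (PDF p. 76)] [cite: NeukirchSchmidtWingberg2008, I §5 Prop. 1.5.2–1.5.4] -/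
theorem spLevel_smul (n k : ℕ) (hγ₂ : γ₂ ∈ κ₁.layerSubgroup n) (F : IwasawaAlgebraO₂ S) (w : layerCohO S κ₁ κ₂ θ 𝔣 n k i) :
    spLevel S κ₁ κ₂ θ 𝔣 n k i (letI := layerModuleO₂ S κ₁ κ₂ γ₁ γ₂ θ 𝔣 hi n k; F • w) =
      (letI := cycLayerModuleO S κ₁ γ₁ θ (suppPF p 𝔣) hi n k; phi0 S F • spLevel S κ₁ κ₂ θ 𝔣 n k i w) := by
  letI i0 := levelModuleO S (suppPF p 𝔣) θ (JohnsonLeungKings2011.pairLayerSubgroup κ₁ κ₂ n) k i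
  letI i1 := layerModuleO₁ S κ₁ κ₂ γ₁ γ₂ θ 𝔣 hi n k
  letI i2 := layerModuleO₂ S κ₁ κ₂ γ₁ γ₂ θ 𝔣 hi n k
  letI j0 := levelModuleO S (suppPF p 𝔣) θ (κ₁.layerSubgroup n) k i
  letI jΛ := cycLayerModuleO S κ₁ γ₁ θ (suppPF p 𝔣) hi n k
  letI j1 := cycLayerModuleInner S κ₁ θ 𝔣 (i := i) n k
  letI j2 := cycLayerModuleO₂ S κ₁ γ₁ θ 𝔣 hi n k
  obtain ⟨hC₀, hC, hX₂, hX₁⟩ := layerModuleO_spec S κ₁ κ₂ γ₁ γ₂ θ 𝔣 hi n k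
  obtain ⟨-, h₁, h₂⟩ := layerPsiO_comm_and_locallyNilpotent S κ₁ κ₂ γ₁ γ₂ θ 𝔣 n k hi
  obtain ⟨hC', hX'⟩ := cycLayerModuleO_spec S κ₁ γ₁ θ (suppPF p 𝔣) hi n k
  -- hypotheses on the target structures
  have hC₀' : ∀ (a : padicCoeffIntegers S) (w : cycLayerCohO S κ₁ θ (suppPF p 𝔣) n k i), (PowerSeries.C a : PowerSeries (padicCoeffIntegers S)) • w = a • w :=
    fun a w ↦ by rw [cycLayerModuleInner_smul, PowerSeries.constantCoeff_C]
  have hC'' : ∀ (g : PowerSeries (padicCoeffIntegers S)) (w : cycLayerCohO S κ₁ θ (suppPF p 𝔣) n k i), (PowerSeries.C g : IwasawaAlgebraO₂ S) • w = g • w :=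
    fun g w ↦ by rw [cycLayerModuleO₂_smul, cycLayerModuleInner_smul, phi0_C, hC']
  have hX₂' : ∀ w : cycLayerCohO S κ₁ θ (suppPF p 𝔣) n k i, (PowerSeries.X : PowerSeries (padicCoeffIntegers S)) • w = (0 : Module.End (padicCoeffIntegers S) _) w :=
    fun w ↦ by rw [cycLayerModuleInner_smul, PowerSeries.constantCoeff_X, zero_smul, LinearMap.zero_apply]
  have hX₁' : ∀ w : cycLayerCohO S κ₁ θ (suppPF p 𝔣) n k i, (PowerSeries.X : IwasawaAlgebraO₂ S) • w = cycLayerPsiO S κ₁ θ (suppPF p 𝔣) n k i γ₁ w :=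
    fun w ↦ by rw [cycLayerModuleO₂_smul, phi0_X, hX']
  -- the corestriction as an `𝒪`-linear map intertwining the operators
  let f : layerCohO S κ₁ κ₂ θ 𝔣 n k i →ₗ[padicCoeffIntegers S] cycLayerCohO S κ₁ θ (suppPF p 𝔣) n k i :=
    { toFun := spLevel S κ₁ κ₂ θ 𝔣 n k i
      map_add' := map_add _
      map_smul' := fun c y ↦ spLevel_layerScalarO S κ₁ κ₂ θ 𝔣 n k i c y }
  have hf₁ : ∀ y, f (layerPsiO S κ₁ κ₂ θ 𝔣 n k i γ₁ y) = cycLayerPsiO S κ₁ θ (suppPF p 𝔣) n k i γ₁ (f y) := fun y ↦ by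
    change spLevel S κ₁ κ₂ θ 𝔣 n k i (layerConjO S κ₁ κ₂ θ 𝔣 n k i γ₁ y - y) =
      cycLayerConjO S κ₁ θ (suppPF p 𝔣) n k i γ₁ (spLevel S κ₁ κ₂ θ 𝔣 n k i y) - spLevel S κ₁ κ₂ θ 𝔣 n k i y
    rw [map_sub, spLevel_layerConjO]
  have hf₂ : ∀ y, f (layerPsiO S κ₁ κ₂ θ 𝔣 n k i γ₂ y) = (0 : Module.End (padicCoeffIntegers S) _) (f y) := fun y ↦ by
    change spLevel S κ₁ κ₂ θ 𝔣 n k i (layerConjO S κ₁ κ₂ θ 𝔣 n k i γ₂ y - y) = 0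
    rw [map_sub, spLevel_layerConjO, cycLayerConjO, levelConjO_eq_self_of_mem S (suppPF p 𝔣) θ hγ₂ (κ₁.isOpen_layerSubgroup n) k hi, sub_self]
  exact map_smul₂_of_comp_eq hC₀ hC hX₂ hX₁ hC₀' hC'' hX₂' hX₁' h₁ h₂ f hf₁ hf₂ F w

end Level

/-! ## §2 `res` is `Λ`-semilinear along `φ₀`; the untwisted specialisation `s : H1/fH1 →ₗ[Λ_𝒪] B` -/

section Data

variable {S} {κ₁ κ₂ : ZpExtension K p} {γ₁ γ₂ : absoluteGaloisGroup K} {θ : absoluteGaloisGroup K →ₜ* (padicCoeffIntegers S)ˣ} {𝔣 : Ideal (𝓞 K)}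
  {D₂ : IwasawaCohomologyDataO S κ₁ κ₂ γ₁ γ₂ θ 𝔣 1} {D₁ : CycIwasawaCohomologyDataO S κ₁ γ₁ θ (suppPF p 𝔣) 1}
  {res : D₂.H →+ D₁.H} (hres : ∀ (n k : ℕ) (x : D₂.H), D₁.proj n k (res x) = spLevel S κ₁ κ₂ θ 𝔣 n k 1 (D₂.proj n k x))
  (hγ₂ : γ₂ ∈ κ₁.kerSubgroup)
include hres hγ₂

/-- ★★ **`res (F • x) = φ₀ F • res x` for EVERY `F ∈ Λ_{𝒪,2}`** (dual basis: `γ₂ ∈ Gal(K̄/K^{(1)}_∞)`): levelwise by `spLevel_smul` and the rigidity of the pins on both data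
(`proj_smul_eq_layer_smul`, `proj_smul_eq_cycLayer_smul`), then (P3) of `D₁`. [cite: Kaplansky1954, §19 statement (a) (PDF p. 76)] [cite: NeukirchSchmidtWingberg2008, I §5 Prop. 1.5.2–1.5.4] -/
theorem coresHom_smul (F : IwasawaAlgebraO₂ S) (x : D₂.H) : res (F • x) = phi0 S F • res x := by
  refine sub_eq_zero.mp (D₁.proj_injective _ fun n k ↦ ?_)
  rw [map_sub, hres, proj_smul_eq_layer_smul (Nat.le_succ 1) D₂ n k, spLevel_smul S κ₁ κ₂ γ₁ γ₂ θ 𝔣 (Nat.le_succ 1) n k (κ₁.kerSubgroup_le_layerSubgroup n hγ₂),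
    proj_smul_eq_cycLayer_smul (Nat.le_succ 1) D₁ n k, hres, sub_self]

/-- `res` is `Λ_𝒪`-linear for the constants-embedding `map C : Λ_𝒪 → Λ_{𝒪,2}` of the frame: `res ((map C l) • x) = l • res x` (`φ₀ ∘ map C = id`).
[cite: JohnsonLeungKings2011, §4.1 Def. 4.1 (arXiv p0012:L59–60)] -/
theorem coresHom_map_C_smul (l : IwasawaAlgebraO S) (x : D₂.H) :
    res ((PowerSeries.map (PowerSeries.C : padicCoeffIntegers S →+* PowerSeries (padicCoeffIntegers S)) l : IwasawaAlgebraO₂ S) • x) = l • res x := by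
  rw [coresHom_smul hres hγ₂, phi0_map_C]

/-- ★★★ **THE UNTWISTED SPECIALISATION `s : H1 ⧸ f•H1 →ₗ[Λ_𝒪] B`**: for any `f ∈ Λ_{𝒪,2}` killed by `res` (`hf`) and ANY `Λ_𝒪`-structure on `QuotSMulTop f H1` pinned by the frame's
`hιH : l • x = (map C l) • x`, there is a `Λ_𝒪`-LINEAR `s` with `s [x] = res x` — the binder `s` of `charRoad_E2_of_roadD_junction_exact(_of_torsionBy_eq_bot/_of_isUnit_nsub)` in the
untwisted frame (`b = 0`, `f = C (X − C 0)`; `D` the datum of the character of `T*`). [cite: JohnsonLeungKings2011, Cor. 5.3 (arXiv p0015:L1–20)] [cite: NeukirchSchmidtWingberg2008, I §5 Prop. 1.5.4] -/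
theorem exists_specialisationLinearMap (f : IwasawaAlgebraO₂ S) (hf : ∀ x : D₂.H, res (f • x) = 0)
    [Module (IwasawaAlgebraO S) (QuotSMulTop f D₂.H)]
    (hιH : ∀ (l : IwasawaAlgebraO S) (x : QuotSMulTop f D₂.H),
      l • x = (PowerSeries.map (PowerSeries.C : padicCoeffIntegers S →+* PowerSeries (padicCoeffIntegers S)) l : IwasawaAlgebraO₂ S) • x) :
    ∃ s : QuotSMulTop f D₂.H →ₗ[IwasawaAlgebraO S] D₁.H, ∀ x : D₂.H, s (Submodule.Quotient.mk x) = res x := by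
  have hvan : ∀ y ∈ (f • (⊤ : Submodule (IwasawaAlgebraO₂ S) D₂.H)).toAddSubgroup, res y = 0 := by
    intro y hy
    obtain ⟨m, -, rfl⟩ := (Submodule.mem_smul_pointwise_iff_exists y f ⊤).mp hy
    exact hf m
  refine ⟨{ toFun := QuotientAddGroup.lift _ res hvan, map_add' := fun x y ↦ map_add _ x y, map_smul' := fun l x ↦ ?_ }, fun x ↦ rfl⟩
  obtain ⟨x, rfl⟩ := Submodule.Quotient.mk_surjective _ x
  rw [hιH, ← Submodule.Quotient.mk_smul]
  exact coresHom_map_C_smul hres hγ₂ l x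

omit hγ₂ in
/-- `res` kills `T₂ • H1` when `γ₂ ∈ Gal(K̄/K^{(1)}_∞)` — the hypothesis `hf` of `exists_specialisationLinearMap` for `f = C X = T₂` (p782174 `coresHom_C_X_smul_eq_zero`, re-exported) and for
the frame's spelling `f = C (X − C 0)`. [cite: JohnsonLeungKings2011, §4.2 (arXiv p0012:L109–112)] -/
theorem res_frame_zero_smul_eq_zero (hγ₂ : γ₂ ∈ κ₁.kerSubgroup) (x : D₂.H) :
    res ((PowerSeries.C (PowerSeries.X - PowerSeries.C (0 : padicCoeffIntegers S)) : IwasawaAlgebraO₂ S) • x) = 0 := by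
  rw [map_zero, sub_zero]
  exact coresHom_C_X_smul_eq_zero hres hγ₂ x

/-- ★★★ **The J2 map in the frame's currency at `b = 0`**: `∃ s : QuotSMulTop (C (X − C 0)) H1 →ₗ[Λ_𝒪] B` with `s [x] = res x`, for ANY `Λ_𝒪`-structure pinned by `hιH`.
[cite: JohnsonLeungKings2011, Cor. 5.3 (arXiv p0015:L1–20)] -/
theorem exists_specialisationLinearMap_frame_zero
    [Module (IwasawaAlgebraO S) (QuotSMulTop ((PowerSeries.C (PowerSeries.X - PowerSeries.C (0 : padicCoeffIntegers S)) : IwasawaAlgebraO₂ S)) D₂.H)]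
    (hιH : ∀ (l : IwasawaAlgebraO S) (x : QuotSMulTop ((PowerSeries.C (PowerSeries.X - PowerSeries.C (0 : padicCoeffIntegers S)) : IwasawaAlgebraO₂ S)) D₂.H),
      l • x = (PowerSeries.map (PowerSeries.C : padicCoeffIntegers S →+* PowerSeries (padicCoeffIntegers S)) l : IwasawaAlgebraO₂ S) • x) :
    ∃ s : QuotSMulTop ((PowerSeries.C (PowerSeries.X - PowerSeries.C (0 : padicCoeffIntegers S)) : IwasawaAlgebraO₂ S)) D₂.H →ₗ[IwasawaAlgebraO S] D₁.H,
      ∀ x : D₂.H, s (Submodule.Quotient.mk x) = res x :=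
  exists_specialisationLinearMap hres hγ₂ _ (res_frame_zero_smul_eq_zero hres hγ₂) hιH

end Data

end Summit.BirchSwinnertonDyer.BirchSwinnertonDyer.Theorems.SmallImageRttD2J2

end
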